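import Mathlib
import Summits.Ventures.LatticeQCDFlow.Scaling.UniformJet

/-!
# LatticeQCDFlow / Scaling — slab chains: the two exact cancellations (one free layer; the partial
# replica swap) — file 3 of the slab-chain proof of (LC) at every separation

HONEST FRAMING: exact (Metropolis-corrected) sampling algorithms for lattice gauge theory;
figures of merit are autocorrelation/cost numbers at stated couplings and volumes; no
continuum-physics claim.

Venture `LatticeQCDFlow` (cell pub-lqcd), topic `Scaling`, FANOUT row 30 (lean-1) — OUR WORK (LEAD
LINE 230 (G3′)).  Layers `η : Fin (n+1) → E` with the product law `ν_E = μ^{⊗(n+1)}`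
(`Measure.pi`), and the doubled (replica) space `(Fin (n+1) → E) × (Fin (n+1) → E)` with
`ν_E ⊗ ν_E`.  Two EXACT identities carry the whole census:
* **one free layer** (`integral_mul_eq_zero_of_update`): if the layer `η_i` enters an integrand only
  through a factor `r(η_i, η_j)` (`j ≠ i`) whose `μ`-marginal in the first slot vanishes, the
  integral vanishes (split the coordinate `i` off with `MeasurableEquiv.piFinSuccAbove`, Fubini);
  hence the CHAIN versions `integral_mul_chainProd_eq_zero_of_fst/snd` for products
  `∏_{h∈A} ρ_h(η_h, η_{h+1})` with a layer that is only a first (resp. second) argument;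
* **the partial replica swap** (`pswapEquiv 𝒜`: exchange `η_h ↔ η'_h` exactly at the heights
  `h ∈ 𝒜`) preserves `ν_E ⊗ ν_E` (`measurePreserving_pswap`, through
  `MeasurableEquiv.arrowProdEquivProdArrow` and the coordinatewise swap), so an integrand that is
  ODD under it integrates to zero (`integral_eq_zero_of_pswap_odd`).
Elementary (Mathlib's `Measure.pi` API); nothing is cited as a fact; `def`s `chainProd`, `pswap`,
`pswapEquiv`; no `sorry`.
-/

noncomputable section

open MeasureTheory Filter Topology Finset

namespace Summit.Ventures.LatticeQCDFlow.Theory2.SlabChain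

variable {n : ℕ} {E : Type*} [MeasurableSpace E] (μ : Measure E) [IsProbabilityMeasure μ]

/-! ## 1. One free layer -/

omit [MeasurableSpace E] in
/-- Updating the inserted coordinate of `Fin.insertNth`. [folklore] -/
theorem update_insertNth (i : Fin (n + 1)) (e₀ e : E) (rest : Fin n → E) :
    Function.update (i.insertNth e₀ rest : Fin (n + 1) → E) i e = i.insertNth e rest := by
  funext k
  refine Fin.succAboveCases i ?_ (fun j => ?_) k
  · simp
  · rw [Function.update_of_ne (Fin.succAbove_ne i j)]
    simp

/-- **One free layer.**  If `F` does not depend on the layer `i` and `r(·, e')` has vanishing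
`μ`-integral for every `e'`, then `∫ F(η) r(η_i, η_j) dν_E(η) = 0` (`j ≠ i`). [folklore] -/
theorem integral_mul_eq_zero_of_update {i j : Fin (n + 1)} (hij : j ≠ i)
    {F : (Fin (n + 1) → E) → ℂ} (hFm : Measurable F) {M : ℝ} (hFb : ∀ η, ‖F η‖ ≤ M)
    (hF : ∀ η e, F (Function.update η i e) = F η)
    {r : E → E → ℂ} (hrm : Measurable (Function.uncurry r)) {Mr : ℝ} (hrb : ∀ e e', ‖r e e'‖ ≤ Mr)
    (hr : ∀ e', ∫ e, r e e' ∂μ = 0) :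
    ∫ η, F η * r (η i) (η j) ∂(Measure.pi fun _ : Fin (n + 1) => μ) = 0 := by
  obtain ⟨j', rfl⟩ := Fin.exists_succAbove_eq hij
  set φ := MeasurableEquiv.piFinSuccAbove (fun _ : Fin (n + 1) => E) i with hφ
  have hmp : MeasurePreserving φ (Measure.pi fun _ : Fin (n + 1) => μ)
      (μ.prod (Measure.pi fun _ : Fin n => μ)) :=
    measurePreserving_piFinSuccAbove (fun _ : Fin (n + 1) => μ) i
  rw [← (hmp.symm φ).integral_comp']
  have hM : 0 ≤ M := (norm_nonneg _).trans (hFb (φ.symm (Classical.choice (by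
    by_contra hE
    rw [not_nonempty_iff] at hE
    have := IsProbabilityMeasure.measure_univ (μ := μ.prod (Measure.pi fun _ : Fin n => μ))
    rw [Set.univ_eq_empty_iff.2 hE, measure_empty] at this
    exact zero_ne_one this))))
  -- the integrand on `E × (Fin n → E)` after freezing the free coordinate of `F`
  obtain ⟨e₀⟩ : Nonempty E := by
    by_contra hE
    rw [not_nonempty_iff] at hE
    have := IsProbabilityMeasure.measure_univ (μ := μ)
    rw [Set.univ_eq_empty_iff.2 hE, measure_empty] at this
    exact zero_ne_one this
  have hsymm : ∀ p : E × (Fin n → E), (φ.symm p : Fin (n + 1) → E) = i.insertNth p.1 p.2 :=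
    fun p => rfl
  have hpt : ∀ p : E × (Fin n → E), F (φ.symm p) * r (φ.symm p i) (φ.symm p (i.succAbove j')) =
      F (i.insertNth e₀ p.2) * r p.1 (p.2 j') := by
    rintro ⟨e, rest⟩
    rw [hsymm, Fin.insertNth_apply_same, Fin.insertNth_apply_succAbove,
      ← update_insertNth i e₀ e rest, hF]
  simp_rw [hpt]
  -- integrability on the product
  set G : E × (Fin n → E) → ℂ := fun p => F (i.insertNth e₀ p.2) * r p.1 (p.2 j') with hG
  have hGm : Measurable G := by
    refine (hFm.comp ?_).mul (hrm.comp (measurable_fst.prodMk ((measurable_pi_apply j').comp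
      measurable_snd)))
    have h1 : Measurable fun p : E × (Fin n → E) => (φ.symm (e₀, p.2) : Fin (n + 1) → E) :=
      φ.symm.measurable.comp (measurable_const.prodMk measurable_snd)
    convert h1 using 1
    funext p
    exact (hsymm (e₀, p.2)).symm
  have hGi : Integrable G (μ.prod (Measure.pi fun _ : Fin n => μ)) :=
    Integrable.of_bound hGm.aestronglyMeasurable (M * Mr) (Eventually.of_forall fun p => by
      rw [hG, norm_mul]
      exact mul_le_mul (hFb _) (hrb _ _) (norm_nonneg _) hM)
  change ∫ p, G p ∂(μ.prod (Measure.pi fun _ : Fin n => μ)) = 0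
  rw [integral_prod_symm G hGi]
  refine integral_eq_zero_of_ae (Eventually.of_forall fun rest => ?_)
  simp only [hG, Pi.zero_apply]
  rw [integral_const_mul, hr, mul_zero]

/-! ## 2. Chain products with one free layer -/

/-- The chain product `∏_{h ∈ A} ρ_h(η_h, η_{h+1})` of a family of two-layer functions. [folklore] -/
def chainProd (ρ : Fin (n + 1) → E → E → ℂ) (A : Finset (Fin (n + 1))) (η : Fin (n + 1) → E) : ℂ :=
  ∏ h ∈ A, ρ h (η h) (η (h + 1))

section Chain

variable {ρ : Fin (n + 1) → E → E → ℂ} {Mρ : ℝ}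

/-- The chain product is measurable. [folklore] -/
theorem measurable_chainProd (hρm : ∀ h, Measurable (Function.uncurry (ρ h)))
    (A : Finset (Fin (n + 1))) : Measurable (chainProd ρ A) := by
  unfold chainProd
  refine Finset.measurable_prod _ fun h _ => ?_
  have hm : Measurable fun η : Fin (n + 1) → E => (η h, η (h + 1)) :=
    (measurable_pi_apply h).prodMk (measurable_pi_apply (h + 1))
  exact (hρm h).comp hm

omit [MeasurableSpace E] in
/-- The chain product is bounded by `Mρ^{#A}`. [folklore] -/
theorem norm_chainProd_le (hρb : ∀ h e e', ‖ρ h e e'‖ ≤ Mρ) (A : Finset (Fin (n + 1)))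
    (η : Fin (n + 1) → E) : ‖chainProd ρ A η‖ ≤ Mρ ^ A.card := by
  unfold chainProd
  rw [norm_prod]
  calc ∏ h ∈ A, ‖ρ h (η h) (η (h + 1))‖ ≤ ∏ _h ∈ A, Mρ :=
        prod_le_prod (fun _ _ => norm_nonneg _) fun h _ => hρb h _ _
    _ = Mρ ^ A.card := prod_const Mρ

omit [MeasurableSpace E] in
/-- Updating a layer that is no argument of the chain product does not change it. [folklore] -/
theorem chainProd_update {A : Finset (Fin (n + 1))} {i : Fin (n + 1)} (h1 : ∀ h ∈ A, h ≠ i)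
    (h2 : ∀ h ∈ A, h + 1 ≠ i) (η : Fin (n + 1) → E) (e : E) :
    chainProd ρ A (Function.update η i e) = chainProd ρ A η := by
  unfold chainProd
  refine prod_congr rfl fun h hh => ?_
  rw [Function.update_of_ne (h1 h hh), Function.update_of_ne (h2 h hh)]

/-- **Chain product with a layer that is only a FIRST argument.**  If `h₀ ∈ A`, no `h ∈ A` has
`h + 1 = h₀`, `F` does not depend on the layer `h₀`, and `∫ ρ_{h₀}(e, e') dμ(e) = 0` for all `e'`,
then `∫ F · ∏_{h∈A} ρ_h(η_h, η_{h+1}) dν_E = 0`. [folklore] -/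
theorem integral_mul_chainProd_eq_zero_of_fst (hρm : ∀ h, Measurable (Function.uncurry (ρ h)))
    (hρb : ∀ h e e', ‖ρ h e e'‖ ≤ Mρ) {A : Finset (Fin (n + 1))} {h₀ : Fin (n + 1)} (hh₀ : h₀ ∈ A)
    (hA : ∀ h ∈ A, h + 1 ≠ h₀) {F : (Fin (n + 1) → E) → ℂ} (hFm : Measurable F) {M : ℝ}
    (hFb : ∀ η, ‖F η‖ ≤ M) (hF : ∀ η e, F (Function.update η h₀ e) = F η)
    (hρ : ∀ e', ∫ e, ρ h₀ e e' ∂μ = 0) :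
    ∫ η, F η * chainProd ρ A η ∂(Measure.pi fun _ : Fin (n + 1) => μ) = 0 := by
  have hsplit : ∀ η, F η * chainProd ρ A η =
      (F η * chainProd ρ (A.erase h₀) η) * ρ h₀ (η h₀) (η (h₀ + 1)) := by
    intro η
    unfold chainProd
    rw [← Finset.mul_prod_erase A _ hh₀]
    ring
  simp_rw [hsplit]
  have hM : 0 ≤ Mρ := (norm_nonneg _).trans (hρb h₀ (Classical.choice (by
    by_contra hE
    rw [not_nonempty_iff] at hE
    have := IsProbabilityMeasure.measure_univ (μ := μ)
    rw [Set.univ_eq_empty_iff.2 hE, measure_empty] at this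
    exact zero_ne_one this)) (Classical.choice (by
    by_contra hE
    rw [not_nonempty_iff] at hE
    have := IsProbabilityMeasure.measure_univ (μ := μ)
    rw [Set.univ_eq_empty_iff.2 hE, measure_empty] at this
    exact zero_ne_one this)))
  refine integral_mul_eq_zero_of_update μ (hA h₀ hh₀) (hFm.mul (measurable_chainProd hρm _))
    (M := M * Mρ ^ (A.erase h₀).card) (fun η => ?_) (fun η e => ?_) (hρm h₀) (hρb h₀) hρ
  · rw [Pi.mul_apply, norm_mul]
    exact mul_le_mul (hFb η) (norm_chainProd_le hρb _ η) (norm_nonneg _)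
      ((norm_nonneg _).trans (hFb η))
  · rw [Pi.mul_apply, Pi.mul_apply, hF, chainProd_update (fun h hh => Finset.ne_of_mem_erase hh)
      (fun h hh => hA h (Finset.mem_of_mem_erase hh))]

/-- **Chain product with a layer that is only a SECOND argument.**  If `h₀ ∈ A`, no `h ∈ A` equals
`h₀ + 1`, `F` does not depend on the layer `h₀ + 1`, and `∫ ρ_{h₀}(e, e') dμ(e') = 0` for all `e`,
then `∫ F · ∏_{h∈A} ρ_h(η_h, η_{h+1}) dν_E = 0`. [folklore] -/
theorem integral_mul_chainProd_eq_zero_of_snd (hρm : ∀ h, Measurable (Function.uncurry (ρ h)))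
    (hρb : ∀ h e e', ‖ρ h e e'‖ ≤ Mρ) {A : Finset (Fin (n + 1))} {h₀ : Fin (n + 1)} (hh₀ : h₀ ∈ A)
    (hA : ∀ h ∈ A, h ≠ h₀ + 1) {F : (Fin (n + 1) → E) → ℂ} (hFm : Measurable F) {M : ℝ}
    (hFb : ∀ η, ‖F η‖ ≤ M) (hF : ∀ η e, F (Function.update η (h₀ + 1) e) = F η)
    (hρ : ∀ e, ∫ e', ρ h₀ e e' ∂μ = 0) :
    ∫ η, F η * chainProd ρ A η ∂(Measure.pi fun _ : Fin (n + 1) => μ) = 0 := by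
  have hsplit : ∀ η, F η * chainProd ρ A η =
      (F η * chainProd ρ (A.erase h₀) η) * (fun e e' => ρ h₀ e' e) (η (h₀ + 1)) (η h₀) := by
    intro η
    unfold chainProd
    rw [← Finset.mul_prod_erase A _ hh₀]
    ring
  simp_rw [hsplit]
  have hr'm : Measurable (Function.uncurry fun e e' => ρ h₀ e' e) :=
    (hρm h₀).comp (measurable_snd.prodMk measurable_fst)
  refine integral_mul_eq_zero_of_update μ (hA h₀ hh₀) (hFm.mul (measurable_chainProd hρm _))
    (M := M * Mρ ^ (A.erase h₀).card) (fun η => ?_) (fun η e => ?_) hr'm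
    (fun e e' => hρb h₀ e' e) hρ
  · rw [Pi.mul_apply, norm_mul]
    exact mul_le_mul (hFb η) (norm_chainProd_le hρb _ η) (norm_nonneg _)
      ((norm_nonneg _).trans (hFb η))
  · have hA' : ∀ h ∈ A.erase h₀, h + 1 ≠ h₀ + 1 := fun h hh heq =>
      Finset.ne_of_mem_erase hh (add_right_cancel heq)
    rw [Pi.mul_apply, Pi.mul_apply, hF,
      chainProd_update (fun h hh => hA h (Finset.mem_of_mem_erase hh)) hA']

end Chain

/-! ## 3. The partial replica swap -/

section Swap

variable {ι : Type*}

/-- **Partial replica swap**: exchange the two replicas' layers exactly at the heights in `𝒜`. [folklore] -/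
def pswap (𝒜 : Finset ι) [DecidablePred (· ∈ 𝒜)] (p : (ι → E) × (ι → E)) : (ι → E) × (ι → E) :=
  (fun h => if h ∈ 𝒜 then p.2 h else p.1 h, fun h => if h ∈ 𝒜 then p.1 h else p.2 h)

variable (𝒜 : Finset ι) [DecidablePred (· ∈ 𝒜)]

omit [MeasurableSpace E] in
/-- The partial swap is an involution. [folklore] -/
theorem pswap_pswap (p : (ι → E) × (ι → E)) : pswap 𝒜 (pswap 𝒜 p) = p := by
  obtain ⟨η, η'⟩ := p
  simp only [pswap, Prod.mk.injEq]
  constructor <;> funext h <;> split_ifs <;> rfl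

omit [MeasurableSpace E] in
/-- First replica at a swapped height. [folklore] -/
@[simp] theorem pswap_fst_of_mem {h : ι} (hh : h ∈ 𝒜) (p : (ι → E) × (ι → E)) :
    (pswap 𝒜 p).1 h = p.2 h := by simp [pswap, hh]

omit [MeasurableSpace E] in
/-- Second replica at a swapped height. [folklore] -/
@[simp] theorem pswap_snd_of_mem {h : ι} (hh : h ∈ 𝒜) (p : (ι → E) × (ι → E)) :
    (pswap 𝒜 p).2 h = p.1 h := by simp [pswap, hh]

omit [MeasurableSpace E] in
/-- First replica at an unswapped height. [folklore] -/
@[simp] theorem pswap_fst_of_not_mem {h : ι} (hh : h ∉ 𝒜) (p : (ι → E) × (ι → E)) :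
    (pswap 𝒜 p).1 h = p.1 h := by simp [pswap, hh]

omit [MeasurableSpace E] in
/-- Second replica at an unswapped height. [folklore] -/
@[simp] theorem pswap_snd_of_not_mem {h : ι} (hh : h ∉ 𝒜) (p : (ι → E) × (ι → E)) :
    (pswap 𝒜 p).2 h = p.2 h := by simp [pswap, hh]

/-- The partial swap is measurable. [folklore] -/
theorem measurable_pswap : Measurable (pswap (E := E) 𝒜) := by
  refine (measurable_pi_lambda _ fun h => ?_).prodMk (measurable_pi_lambda _ fun h => ?_)
  · by_cases hh : h ∈ 𝒜
    · simp only [hh, if_true]; exact (measurable_pi_apply h).comp measurable_snd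
    · simp only [hh, if_false]; exact (measurable_pi_apply h).comp measurable_fst
  · by_cases hh : h ∈ 𝒜
    · simp only [hh, if_true]; exact (measurable_pi_apply h).comp measurable_fst
    · simp only [hh, if_false]; exact (measurable_pi_apply h).comp measurable_snd

/-- The partial swap as a measurable equivalence (its own inverse). [folklore] -/
def pswapEquiv : ((ι → E) × (ι → E)) ≃ᵐ ((ι → E) × (ι → E)) where
  toFun := pswap 𝒜
  invFun := pswap 𝒜
  left_inv := pswap_pswap 𝒜
  right_inv := pswap_pswap 𝒜
  measurable_toFun := measurable_pswap 𝒜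
  measurable_invFun := measurable_pswap 𝒜

variable [Fintype ι]

/-- **The partial replica swap preserves `ν_E ⊗ ν_E`** (it is the coordinatewise conditional swap
of `(Fin (n+1) → E × E)` conjugated by `arrowProdEquivProdArrow`). [folklore] -/
theorem measurePreserving_pswap :
    MeasurePreserving (pswap (E := E) 𝒜)
      ((Measure.pi fun _ : ι => μ).prod (Measure.pi fun _ : ι => μ))
      ((Measure.pi fun _ : ι => μ).prod (Measure.pi fun _ : ι => μ)) := by
  set e := MeasurableEquiv.arrowProdEquivProdArrow E E ι with he_def
  have he : MeasurePreserving e (Measure.pi fun _ : ι => μ.prod μ)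
      ((Measure.pi fun _ : ι => μ).prod (Measure.pi fun _ : ι => μ)) :=
    measurePreserving_arrowProdEquivProdArrow E E ι (fun _ => μ) (fun _ => μ)
  set cs : (ι → E × E) → (ι → E × E) := fun ω h => if h ∈ 𝒜 then (ω h).swap else ω h with hcs
  have hc : MeasurePreserving cs (Measure.pi fun _ : ι => μ.prod μ) (Measure.pi fun _ : ι => μ.prod μ) := by
    refine measurePreserving_pi (fun _ => μ.prod μ) (fun _ => μ.prod μ)
      (f := fun h q => if h ∈ 𝒜 then q.swap else q) (fun h => ?_)
    by_cases hh : h ∈ 𝒜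
    · simp only [hh, if_true]
      exact Measure.measurePreserving_swap
    · simp only [hh]
      exact MeasurePreserving.id _
  have hcomp : MeasurePreserving (e ∘ cs ∘ e.symm)
      ((Measure.pi fun _ : ι => μ).prod (Measure.pi fun _ : ι => μ))
      ((Measure.pi fun _ : ι => μ).prod (Measure.pi fun _ : ι => μ)) :=
    he.comp (hc.comp (MeasurePreserving.symm e he))
  have hfwd : ∀ ω : ι → E × E, e (cs ω) = pswap 𝒜 (e ω) := by
    intro ω
    refine Prod.ext (funext fun h => ?_) (funext fun h => ?_) <;>
      by_cases hh : h ∈ 𝒜 <;>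
      simp [he_def, hcs, hh, pswap, MeasurableEquiv.arrowProdEquivProdArrow,
        Equiv.arrowProdEquivProdArrow]
  have hfun : pswap (E := E) 𝒜 = e ∘ cs ∘ e.symm := by
    funext p
    simp only [Function.comp_apply]
    rw [hfwd, MeasurableEquiv.apply_symm_apply]
  rw [hfun]
  exact hcomp

/-- **An integrand odd under a partial replica swap integrates to zero.** [folklore] -/
theorem integral_eq_zero_of_pswap_odd {G : (ι → E) × (ι → E) → ℂ}
    (hG : ∀ p, G (pswap 𝒜 p) = -G p) :
    ∫ p, G p ∂((Measure.pi fun _ : ι => μ).prod (Measure.pi fun _ : ι => μ)) = 0 := by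
  have hmp : MeasurePreserving (pswapEquiv (E := E) 𝒜)
      ((Measure.pi fun _ : ι => μ).prod (Measure.pi fun _ : ι => μ))
      ((Measure.pi fun _ : ι => μ).prod (Measure.pi fun _ : ι => μ)) :=
    measurePreserving_pswap μ 𝒜
  have h := hmp.integral_comp' (g := G)
  have h' : ∫ p, G (pswapEquiv (E := E) 𝒜 p)
      ∂((Measure.pi fun _ : ι => μ).prod (Measure.pi fun _ : ι => μ)) =
      -∫ p, G p ∂((Measure.pi fun _ : ι => μ).prod (Measure.pi fun _ : ι => μ)) := by
    rw [← integral_neg]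
    exact integral_congr_ae (Eventually.of_forall fun p => hG p)
  rw [h'] at h
  have h2 : (2 : ℂ) * ∫ p, G p ∂((Measure.pi fun _ : ι => μ).prod (Measure.pi fun _ : ι => μ)) = 0 := by
    linear_combination -h
  exact (mul_eq_zero.1 h2).resolve_left two_ne_zero

end Swap

end Summit.Ventures.LatticeQCDFlow.Theory2.SlabChain

end
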